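import Summits.QuantumFields.YangMills.Theorems.AllWindowsColdBoxBoxHighLineK3PrimeRowE1WilsonRow
import Summits.QuantumFields.YangMills.Theorems.AllWindowsColdBoxBoxHighLineK3PrimeRowE1Phi

/-!
# U5 K3′ — row «E1-Φ» in the per-row `hKk` currency: `K3RowSum.rowBound_E1_phi`
# (planner ym-idea-2 g19's owner table 2026-08-30T02:11:36Z «hE1r-Φ ← w2 'rowBound_E1_phi'»; fcl-p3 g27's hK3 ROW SUM `tiltCum3_cutSet_size_of_rows`, hypothesis `hE1r`
#  with `Vr β H a := −W4 β H a − β·phiQuartic H a`; LINE-20 U5 ⟨stmt-QuantumFields-24336⟩)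

Width seat `ym-line-sfw-p2-w2` (g33).  Pattern = fcl-p3 g27's ✓`K3RowSum.rowBound_of_quadSize` (`…K3PrimeRowSumRows`): a landed row
`|κ₃^{μ_D}(L, L; V)| ≤ β⁻¹^3·C′·(1+log H)⁵·(1 + √τ·H⁴)` on every measurable `D ⊆ smallField H s` with `E₀[1−1_D] ≤ τ ≤ 1/2` becomes, with `τ := β⁻¹` (`q := 1`),
`K β H := C′·(1+log H)⁵·(1 + √(β⁻¹)·H⁴)/β³` and the budget `β²H⁸·K → 0` (rows `[8θ − 1]`, `[12θ − 3/2]`, strict for every `θ < 1/10`):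

* the `β`-dependent form of the pattern is w3 g42's ✓`K3RowSum.rowBound_of_quadSize'` (`…K3PrimeRowE1WilsonRow`, imported — not restated);
* `GaussRestrict.abs_tiltCum3_muSet_linCurvSq_linCurvSq_negBeta_mul_phiQuartic_le` — the row for the vertex `−β·phiQuartic` in the premise shape `β⁻¹^3·C·(1+log H)⁵·(1+√τ·H⁴)`;
* ★ `K3RowSum.rowBound_E1_phi` — the vertex `fun a => -(β * phiQuartic H a)` (from ✓`GaussRestrict.abs_tiltCum3_muSet_linCurvSq_linCurvSq_const_mul_phiQuartic_le`
  at `c := −β`: `|−β|·β⁻¹^4 = β⁻¹^3`), and `K3RowSum.rowBound_E1_phi'` — the same for the vertex `fun a => -β * phiQuartic H a`.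

No definitions; tree only; standard axioms.  HONEST LABEL: helper-grade U5 prep (ONE half of the hypothesis `hE1r` of the hK3 row sum; hK3 itself is NOT proved:
`hE1r`-Wilson, `hRA`, `hRB`, `hRC` are other seats' and open at this minute); U5, ⟨24336⟩, ⟨24004⟩ remain OPEN; route AllWindowsColdBox is DRAFT; no crux, rung or
summit is proved; **the Yang–Mills mass gap is NOT proved by this file; no summit is proved by a line.**
-/

set_option autoImplicit false

noncomputable section

open MeasureTheory
open Literature.Probability.LatticeModels (Site)
open Summit.QuantumFields.YangMills.Theorems.WeakCouplingRates (plaq12At)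

namespace Summit.QuantumFields.YangMills.Theorems.AllWindowsColdBoxBoxHighLine

/-- **The `−β·phiQuartic` row in the `β⁻¹^3` premise shape** of ✓`K3RowSum.rowBound_of_quadSize'`: `|−β|·β⁻¹^4 = β⁻¹^3` in
✓`GaussRestrict.abs_tiltCum3_muSet_linCurvSq_linCurvSq_const_mul_phiQuartic_le` at `c := −β`. -/
theorem GaussRestrict.abs_tiltCum3_muSet_linCurvSq_linCurvSq_negBeta_mul_phiQuartic_le : ∃ C : ℝ, 0 ≤ C ∧ ∀ H : ℕ, 1 ≤ H → ∀ β : ℝ, 0 < β →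
    ∀ x y : Site 4, ∀ μ₁ ν₁ μ₂ ν₂ : Fin 4, ∀ s : ℝ, 0 ≤ s → ∀ D : Set (LandauFree H → E3), MeasurableSet D → D ⊆ smallField H s →
    ∀ τ : ℝ, gaussAvg β H (fun a => 1 - D.indicator (fun _ => (1 : ℝ)) a) ≤ τ → τ ≤ 1 / 2 →
    |Tilt.tiltCum3 ((((volume : Measure (LandauFree H → E3)).restrict D).withDensity fun a => ENNReal.ofReal (gaussWeight β H a)))
        (fun a => -β * phiQuartic H a) 0 (linCurvSq H (x, μ₁, ν₁)) (linCurvSq H (y, μ₂, ν₂))| ≤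
      β⁻¹ ^ 3 * (C * (1 + Real.log H) ^ 5 * (1 + Real.sqrt τ * (H : ℝ) ^ 4)) := by
  obtain ⟨C, hC0, hC⟩ := GaussRestrict.abs_tiltCum3_muSet_linCurvSq_linCurvSq_const_mul_phiQuartic_le
  refine ⟨C, hC0, fun H hH β hβ x y μ₁ ν₁ μ₂ ν₂ s hs0 D hDm hDs τ hτ hτ2 => ?_⟩
  refine (hC H hH β hβ (-β) x y μ₁ ν₁ μ₂ ν₂ s hs0 D hDm hDs τ hτ hτ2).trans (le_of_eq ?_)
  rw [abs_neg, abs_of_pos hβ]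
  have hβ0 : β ≠ 0 := hβ.ne'
  calc β * (β⁻¹ ^ 4 * (C * (1 + Real.log H) ^ 5 * (1 + Real.sqrt τ * (H : ℝ) ^ 4)))
      = (β * β⁻¹) * (β⁻¹ ^ 3 * (C * (1 + Real.log H) ^ 5 * (1 + Real.sqrt τ * (H : ℝ) ^ 4))) := by ring
    _ = β⁻¹ ^ 3 * (C * (1 + Real.log H) ^ 5 * (1 + Real.sqrt τ * (H : ℝ) ^ 4)) := by rw [mul_inv_cancel₀ hβ0, one_mul]

namespace K3RowSum

/-- ★ **Row E1-Φ in the per-row `hKk` currency, BY NAME** — the vertex `fun a => -(β * phiQuartic H a)` (the `Φ⁴` half of `Vr β H a = −W4 β H a − β·phiQuartic H a`),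
from ✓`GaussRestrict.abs_tiltCum3_muSet_linCurvSq_linCurvSq_const_mul_phiQuartic_le` at `c := −β`; `q := 1`; budgets `[8θ − 1]`, `[12θ − 3/2]`. -/
theorem rowBound_E1_phi : ∀ θ : ℝ, 0 < θ → θ < 1 / 10 → ∃ q : ℝ, ∃ K : ℝ → ℕ → ℝ,
      (∃ β₀ : ℝ, 1 ≤ β₀ ∧ ∀ β : ℝ, β₀ ≤ β → ∀ H : ℕ, 1 ≤ H → β ^ θ ≤ (H : ℝ) → (H : ℝ) ≤ β ^ θ + 1 →
        ∀ D : Set (LandauFree H → E3), MeasurableSet D → D ⊆ smallField H (β ^ ((1 / 8 - θ / 4) - 1 / 2)) → (∀ a, -a ∈ D ↔ a ∈ D) →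
        gaussAvg β H (fun a => 1 - D.indicator (fun _ => (1 : ℝ)) a) ≤ β ^ (-q) →
        gaussAvg β H (fun a => 1 - D.indicator (fun _ => (1 : ℝ)) a) ≤ 1 / 2 → (∀ a ∈ D, |tiltU β H a| ≤ 2) → ∀ x y : Site 4,
        |Tilt.tiltCum3 (((volume : Measure (LandauFree H → E3)).restrict D).withDensity fun a => ENNReal.ofReal (gaussWeight β H a))
            (fun a => -(β * phiQuartic H a)) 0 (linCurvSq H (plaq12At x)) (linCurvSq H (plaq12At y))| ≤ K β H) ∧
      (∀ ε : ℝ, 0 < ε → ∃ β₀ : ℝ, 1 ≤ β₀ ∧ ∀ β : ℝ, β₀ ≤ β → ∀ H : ℕ, 1 ≤ H → (H : ℝ) ≤ β ^ θ + 1 → β ^ 2 * (H : ℝ) ^ 8 * K β H ≤ ε) := by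
  intro θ hθ hθ'
  obtain ⟨C, -, hC⟩ := GaussRestrict.abs_tiltCum3_muSet_linCurvSq_linCurvSq_negBeta_mul_phiQuartic_le
  refine rowBound_of_quadSize' hθ hθ' (C' := C) (V := fun β H a => -(β * phiQuartic H a))
    fun H hH β hβ x y μ₁ ν₁ μ₂ ν₂ s hs0 D hDm hDs τ hτ hτ2 => ?_
  have e : (fun a : LandauFree H → E3 => -(β * phiQuartic H a)) = fun a => -β * phiQuartic H a := by
    funext a; simp only [neg_mul]
  rw [e]
  exact hC H hH β hβ x y μ₁ ν₁ μ₂ ν₂ s hs0 D hDm hDs τ hτ hτ2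

/-- Row E1-Φ for the vertex spelled `fun a => -β * phiQuartic H a`. -/
theorem rowBound_E1_phi' : ∀ θ : ℝ, 0 < θ → θ < 1 / 10 → ∃ q : ℝ, ∃ K : ℝ → ℕ → ℝ,
      (∃ β₀ : ℝ, 1 ≤ β₀ ∧ ∀ β : ℝ, β₀ ≤ β → ∀ H : ℕ, 1 ≤ H → β ^ θ ≤ (H : ℝ) → (H : ℝ) ≤ β ^ θ + 1 →
        ∀ D : Set (LandauFree H → E3), MeasurableSet D → D ⊆ smallField H (β ^ ((1 / 8 - θ / 4) - 1 / 2)) → (∀ a, -a ∈ D ↔ a ∈ D) →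
        gaussAvg β H (fun a => 1 - D.indicator (fun _ => (1 : ℝ)) a) ≤ β ^ (-q) →
        gaussAvg β H (fun a => 1 - D.indicator (fun _ => (1 : ℝ)) a) ≤ 1 / 2 → (∀ a ∈ D, |tiltU β H a| ≤ 2) → ∀ x y : Site 4,
        |Tilt.tiltCum3 (((volume : Measure (LandauFree H → E3)).restrict D).withDensity fun a => ENNReal.ofReal (gaussWeight β H a))
            (fun a => -β * phiQuartic H a) 0 (linCurvSq H (plaq12At x)) (linCurvSq H (plaq12At y))| ≤ K β H) ∧
      (∀ ε : ℝ, 0 < ε → ∃ β₀ : ℝ, 1 ≤ β₀ ∧ ∀ β : ℝ, β₀ ≤ β → ∀ H : ℕ, 1 ≤ H → (H : ℝ) ≤ β ^ θ + 1 → β ^ 2 * (H : ℝ) ^ 8 * K β H ≤ ε) := by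
  intro θ hθ hθ'
  obtain ⟨C, -, hC⟩ := GaussRestrict.abs_tiltCum3_muSet_linCurvSq_linCurvSq_negBeta_mul_phiQuartic_le
  exact rowBound_of_quadSize' hθ hθ' (C' := C) (V := fun β H a => -β * phiQuartic H a) hC

end K3RowSum

end Summit.QuantumFields.YangMills.Theorems.AllWindowsColdBoxBoxHighLine
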